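import Summits.QuantumAdvantage.QuantumAdvantage.Theorems.LinnikCubicClassGroupsDegreeOnePrimesEscapeUpperShadowAdd
import HarnessLib

/-!
# Crux `DegreeOnePrimesEscape` (stmt-QuantumAdvantage-11543) — the upper shadow from the DEGREE-LOCAL additive class PNT

Line `dedekind-s3-collision`.  The registered stub `stub_upperShadowAdd` (`…UpperShadowAdd.lean`) consumes the
additive class PNT dichotomy with ONE constant `c₁` for ALL degrees (the registered `stub_classPNTAdditive`,
still open in that uniform form).  What the tree PROVES unconditionally is the DEGREE-LOCAL dichotomy
(`classPNTAdditive_allFields n hn : ∃ c₁(n) > 0, ∀ K of degree n, …`, p179022).  This file re-proves the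
upper shadow from the degree-local hypothesis, degree by degree — the proof is the same field-by-field
argument (sum over `C ∈ M`, drop the `χ₁`-term by `Dock.sum_subgroup_char_re_nonneg`, `|M|·[Cl:M] = h`);
only the order of the quantifiers `∀ n` / `∃ c₁` changes.  Cell B2b-1 (linnik-cubic), PART B; value =
theorem (the additive line of the crux closed from landed material), NOT summit progress.
-/

noncomputable section

open scoped NumberField nonZeroDivisors
open Literature.NumberTheory.LFunctions Literature.NumberTheory.LFunctions.NumberField

namespace Summit.QuantumAdvantage.QuantumAdvantage.Theorems.DegreeOnePrimesEscape

open Classical in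
/-- Sum form, degree-local: from the additive dichotomy at degree `n`, `32·[Cl:M]·∑_{C∈M} π_C(x) ≤ 33·Li(x)`
for `x ≥ Q^{max c₁ 1}` and every `K` of degree `n`. -/
theorem Dock.subgroupClassSum_le_of_additive_local (n : ℕ) (hn : 1 < n)
    (hAdd : (∃ c₁ : ℝ, 0 < c₁ ∧ ∀ (K : Type) [Field K] [NumberField K], Module.finrank ℚ K = n →
      ((∀ (C : ClassGroup (𝓞 K)) (x : ℝ), ThornerZaman.condQn K ^ c₁ ≤ x →
          |(primeIdealClassCount K C x : ℝ) - offsetLogIntegral x / NumberField.classNumber K| ≤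
            offsetLogIntegral x / (32 * NumberField.classNumber K)) ∨
        ∃ (χ₁ : ClassGroup (𝓞 K) →* ℂˣ) (β₁ : ℝ), χ₁ * χ₁ = 1 ∧
          1 - 1 / (8 * Real.log (ThornerZaman.condQn K)) < β₁ ∧ β₁ < 1 ∧
          classGroupLFunction K χ₁ β₁ = 0 ∧
          ∀ (C : ClassGroup (𝓞 K)) (x : ℝ), ThornerZaman.condQn K ^ c₁ ≤ x →
            |(primeIdealClassCount K C x : ℝ) -
                (offsetLogIntegral x - ((χ₁ C : ℂ)).re * offsetLogIntegral (x ^ β₁)) /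
                  NumberField.classNumber K| ≤
              offsetLogIntegral x / (32 * NumberField.classNumber K)))) :
    ∃ C₀ : ℝ, ∀ (K : Type) [Field K] [NumberField K], Module.finrank ℚ K = n →
      ∀ x : ℝ, ThornerZaman.condQn K ^ C₀ ≤ x →
      ∀ M : Subgroup (ClassGroup (𝓞 K)),
        32 * (M.index : ℝ) * ∑ C ∈ Finset.univ.filter (· ∈ M), (primeIdealClassCount K C x : ℝ)
          ≤ 33 * offsetLogIntegral x := by
  obtain ⟨c₁, hc₁, H⟩ := hAdd
  refine ⟨max c₁ 1, ?_⟩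
  intro K _ _ hKn x hx M
  have hK : 1 < Module.finrank ℚ K := by rw [hKn]; exact hn
  set Q : ℝ := ThornerZaman.condQn K with hQdef
  set h : ℕ := NumberField.classNumber K with hhdef
  have hQ12 : 12 ≤ Q := ThornerZaman.twelve_le_condQn (K := K) hK
  have hQ1 : 1 ≤ Q := by linarith
  have hxc₁ : Q ^ c₁ ≤ x := le_trans (Real.rpow_le_rpow_of_exponent_le hQ1 (le_max_left _ _)) hx
  have hx12 : 12 ≤ x := by
    calc (12 : ℝ) ≤ Q := hQ12
      _ = Q ^ (1 : ℝ) := (Real.rpow_one Q).symm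
      _ ≤ Q ^ (max c₁ 1) := Real.rpow_le_rpow_of_exponent_le hQ1 (le_max_right _ _)
      _ ≤ x := hx
  -- Li(x) ≥ 0 and Li(x^β) ≥ 0 for β ≥ 1/2
  have hLimono := strictMonoOn_offsetLogIntegral_holds
  have hLi_nonneg : ∀ y : ℝ, 2 ≤ y → 0 ≤ offsetLogIntegral y := by
    intro y hy
    rcases eq_or_lt_of_le hy with h2 | h2
    · rw [← h2, offsetLogIntegral_two]
    · have := hLimono (show (2:ℝ) ∈ Set.Ioi 1 by norm_num) (show y ∈ Set.Ioi 1 from by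
        simp only [Set.mem_Ioi]; linarith) h2
      rw [offsetLogIntegral_two] at this; exact this.le
  have hLix : 0 ≤ offsetLogIntegral x := hLi_nonneg x (by linarith)
  -- index · |M| = h
  have hF : ((Finset.univ.filter (· ∈ M)).card : ℝ) * (M.index : ℝ) = h := by
    have h1 : (Finset.univ.filter (· ∈ M)).card = Nat.card M := by
      rw [Nat.card_eq_fintype_card, ← Fintype.card_subtype]
    have h2 : Nat.card M * M.index = Nat.card (ClassGroup (𝓞 K)) := Subgroup.card_mul_index M
    have h3 : Nat.card (ClassGroup (𝓞 K)) = h := by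
      rw [hhdef, NumberField.classNumber, Nat.card_eq_fintype_card]
    rw [h1]
    exact_mod_cast h2.trans h3
  have hhpos : (0 : ℝ) < h := by exact_mod_cast NumberField.classNumber_pos (K := K)
  -- an additive per-class bound `π_C ≤ m_C/h + Li/(32h)` from `|π_C − m_C/h| ≤ Li/(32h)`
  have key : ∀ (π m : ℝ), |π - m| ≤ offsetLogIntegral x / (32 * h) → π ≤ m + offsetLogIntegral x / (32 * h) := by
    intro π m hπ
    have h1 := (abs_sub_le_iff.1 hπ).1
    linarith
  set F := Finset.univ.filter (· ∈ M) with hFdef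
  have hFcard : (F.card : ℝ) * (M.index : ℝ) = h := hF
  rcases H K hKn with hA | ⟨χ₁, β₁, -, hβlo, hβhi, -, hB⟩
  · -- no exceptional zero
    have hC : ∀ C : ClassGroup (𝓞 K),
        (primeIdealClassCount K C x : ℝ) ≤ offsetLogIntegral x / h + offsetLogIntegral x / (32 * h) :=
      fun C => key _ _ (hA C x hxc₁)
    calc 32 * (M.index : ℝ) * ∑ C ∈ F, (primeIdealClassCount K C x : ℝ)
        ≤ 32 * (M.index : ℝ) * ∑ C ∈ F, (offsetLogIntegral x / h + offsetLogIntegral x / (32 * h)) := by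
          gcongr with C hC'
          exact hC C
      _ = 33 * offsetLogIntegral x * ((F.card : ℝ) * (M.index : ℝ) / h) := by
          rw [Finset.sum_const, nsmul_eq_mul]; field_simp; ring
      _ = 33 * offsetLogIntegral x := by rw [hFcard, div_self hhpos.ne', mul_one]
  · -- exceptional (χ₁, β₁)
    have hβhalf : (1:ℝ) / 2 ≤ β₁ := by
      have hlogQ : Real.log 12 ≤ Real.log Q := Real.log_le_log (by norm_num) hQ12
      have hlog12 : (1 : ℝ) < Real.log 12 := by
        have := Real.exp_one_lt_d9
        rw [Real.lt_log_iff_exp_lt (by norm_num)]; linarith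
      have hlogQpos : 0 < Real.log Q := by linarith
      have : 1 / (8 * Real.log Q) ≤ 1 / 8 := by
        rw [div_le_div_iff₀ (by positivity) (by norm_num)]; nlinarith
      linarith
    have hxβ : 2 ≤ x ^ β₁ := by
      have hx1 : (1:ℝ) ≤ x := by linarith
      calc (2 : ℝ) ≤ 12 ^ ((1:ℝ) / 2) := by
            rw [show (12:ℝ) = 2 ^ (2:ℝ) * 3 by norm_num, Real.mul_rpow (by positivity) (by norm_num),
              ← Real.rpow_mul (by norm_num)]
            norm_num
            have : (1:ℝ) ≤ (3:ℝ) ^ ((1:ℝ)/2) := Real.one_le_rpow (by norm_num) (by norm_num)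
            linarith
        _ ≤ x ^ ((1:ℝ) / 2) := Real.rpow_le_rpow (by norm_num) hx12 (by norm_num)
        _ ≤ x ^ β₁ := Real.rpow_le_rpow_of_exponent_le hx1 hβhalf
    have hLiβ : 0 ≤ offsetLogIntegral (x ^ β₁) := hLi_nonneg _ hxβ
    have hC : ∀ C : ClassGroup (𝓞 K), (primeIdealClassCount K C x : ℝ) ≤
        (offsetLogIntegral x - ((χ₁ C : ℂ)).re * offsetLogIntegral (x ^ β₁)) / h
          + offsetLogIntegral x / (32 * h) :=
      fun C => key _ _ (hB C x hxc₁)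
    have hsign : 0 ≤ ∑ C ∈ F, ((χ₁ C : ℂ)).re := Dock.sum_subgroup_char_re_nonneg M χ₁
    have hsum : ∑ C ∈ F, ((offsetLogIntegral x - ((χ₁ C : ℂ)).re * offsetLogIntegral (x ^ β₁)) / (h : ℝ)
          + offsetLogIntegral x / (32 * h))
        = ((F.card : ℝ) * offsetLogIntegral x
            - (∑ C ∈ F, ((χ₁ C : ℂ)).re) * offsetLogIntegral (x ^ β₁)) / h
          + (F.card : ℝ) * (offsetLogIntegral x / (32 * h)) := by
      rw [Finset.sum_add_distrib, ← Finset.sum_div, Finset.sum_sub_distrib, Finset.sum_const, nsmul_eq_mul,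
        Finset.sum_mul, Finset.sum_const, nsmul_eq_mul]
    have hdrop : ((F.card : ℝ) * offsetLogIntegral x
            - (∑ C ∈ F, ((χ₁ C : ℂ)).re) * offsetLogIntegral (x ^ β₁)) / h
          ≤ (F.card : ℝ) * offsetLogIntegral x / h := by
      apply div_le_div_of_nonneg_right _ hhpos.le
      nlinarith [mul_nonneg hsign hLiβ]
    have hcoef : 0 ≤ 32 * (M.index : ℝ) := by positivity
    calc 32 * (M.index : ℝ) * ∑ C ∈ F, (primeIdealClassCount K C x : ℝ)
        ≤ 32 * (M.index : ℝ) * ∑ C ∈ F,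
            ((offsetLogIntegral x - ((χ₁ C : ℂ)).re * offsetLogIntegral (x ^ β₁)) / h
              + offsetLogIntegral x / (32 * h)) := by
          gcongr with C hC'
          exact hC C
      _ = 32 * (M.index : ℝ) * (((F.card : ℝ) * offsetLogIntegral x
            - (∑ C ∈ F, ((χ₁ C : ℂ)).re) * offsetLogIntegral (x ^ β₁)) / h
          + (F.card : ℝ) * (offsetLogIntegral x / (32 * h))) := by rw [hsum]
      _ ≤ 32 * (M.index : ℝ) * ((F.card : ℝ) * offsetLogIntegral x / h
          + (F.card : ℝ) * (offsetLogIntegral x / (32 * h))) := by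
          apply mul_le_mul_of_nonneg_left _ hcoef
          linarith [hdrop]
      _ = 33 * offsetLogIntegral x * ((F.card : ℝ) * (M.index : ℝ) / h) := by
          field_simp; ring
      _ = 33 * offsetLogIntegral x := by rw [hFcard, div_self hhpos.ne', mul_one]

open Classical in
/-- **The upper shadow from the DEGREE-LOCAL additive class PNT dichotomy** (line `dedekind-s3-collision`):
for every `n > 1`, the additive dichotomy at degree `n` gives `C₀ = C₀(n)` with
`32·[Cl(K):M]·#{𝔭 prime, N𝔭 ≤ x, [𝔭] ∈ M} ≤ 33·Li(x)` for every `K` of degree `n`, `x ≥ Q^{C₀}`, every `M`. -/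
theorem upperShadow_of_additive_local (n : ℕ) (hn : 1 < n) :
    (∃ c₁ : ℝ, 0 < c₁ ∧ ∀ (K : Type) [Field K] [NumberField K], Module.finrank ℚ K = n →
      ((∀ (C : ClassGroup (𝓞 K)) (x : ℝ), ThornerZaman.condQn K ^ c₁ ≤ x →
          |(primeIdealClassCount K C x : ℝ) - offsetLogIntegral x / NumberField.classNumber K| ≤
            offsetLogIntegral x / (32 * NumberField.classNumber K)) ∨
        ∃ (χ₁ : ClassGroup (𝓞 K) →* ℂˣ) (β₁ : ℝ), χ₁ * χ₁ = 1 ∧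
          1 - 1 / (8 * Real.log (ThornerZaman.condQn K)) < β₁ ∧ β₁ < 1 ∧
          classGroupLFunction K χ₁ β₁ = 0 ∧
          ∀ (C : ClassGroup (𝓞 K)) (x : ℝ), ThornerZaman.condQn K ^ c₁ ≤ x →
            |(primeIdealClassCount K C x : ℝ) -
                (offsetLogIntegral x - ((χ₁ C : ℂ)).re * offsetLogIntegral (x ^ β₁)) /
                  NumberField.classNumber K| ≤
              offsetLogIntegral x / (32 * NumberField.classNumber K))) →
    ∃ C₀ : ℝ, ∀ (K : Type) [Field K] [NumberField K], Module.finrank ℚ K = n →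
      ∀ x : ℝ, ThornerZaman.condQn K ^ C₀ ≤ x →
      ∀ M : Subgroup (ClassGroup (𝓞 K)),
        32 * (M.index : ℝ) *
            (Set.ncard {P : Ideal (𝓞 K) | P.IsPrime ∧ (Ideal.absNorm P : ℝ) ≤ x ∧
                ∃ hP : P ∈ (Ideal (𝓞 K))⁰, ClassGroup.mk0 ⟨P, hP⟩ ∈ M} : ℝ)
          ≤ 33 * offsetLogIntegral x := by
  intro hAdd
  classical
  obtain ⟨C₀, hC₀⟩ := Dock.subgroupClassSum_le_of_additive_local n hn hAdd
  refine ⟨C₀, fun K _ _ hK x hx M => ?_⟩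
  have hset : {P : Ideal (𝓞 K) | P.IsPrime ∧ (Ideal.absNorm P : ℝ) ≤ x ∧
        ∃ hP : P ∈ (Ideal (𝓞 K))⁰, ClassGroup.mk0 ⟨P, hP⟩ ∈ M}
      = {P : Ideal (𝓞 K) | P.IsPrime ∧ (Ideal.absNorm P : ℝ) ≤ x ∧
        ∃ hP : P ∈ (Ideal (𝓞 K))⁰, ClassGroup.mk0 ⟨P, hP⟩ ∈ Finset.univ.filter (· ∈ M)} := by
    ext P; simp
  have h := hC₀ K hK x hx M
  rw [hset, Dock.ncard_primes_class_mem_eq_sum K x (Finset.univ.filter (· ∈ M))]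
  push_cast
  convert h using 2

end Summit.QuantumAdvantage.QuantumAdvantage.Theorems.DegreeOnePrimesEscape

end
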